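import Summits.CriticalPhenomena.PercolationContinuityZ3.Theorems.PercNearOneGluingNoHeavyQuantGateMoveBlobPartial
import Summits.CriticalPhenomena.PercolationContinuityZ3.Theorems.PercNearOneGluingNoHeavyQuantGateSliceDominated
import HarnessLib

/-!
# QUANT lane R8, T-DEC, leg (III): the BLOB GATE MOVE — `slice (gate_q μ) a g ⟶ gate_q (slice μ a g)` is a DEC move when no unshifted
# atom lies strictly below the blob; hence SDEC (up to any gate level) is closed under hanging a SINGLE RELAY `{0,1;g}` (`g ≥ x`) beside
# ANY law under a common gate — no domination hypothesis (part 3 of 3)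

builds on p205010 (kernel theorem, internal audit signed; external expert review pending)

Support file (`--supports stmt-CriticalPhenomena-4575`), QUANT lane typer seat prim-quant-stmt (gen 27), rung R8 of
`run/shared/lean/prim/quant/LADDER.md`.  Theorems only, standard axioms, no sorries, no definitions.  Parts 1–2: `…QuantGateMoveBlobRates`,
`…QuantGateMoveBlobPartial`.  Continues typer g26's `…QuantGateMove` (`LawDec.GateMove` = GM′, whose blob instance this is), lead g27's
`…QuantGateSliceDominated` (the regime `μ 0 ≥ 1 − g`) and typer g24's slice theorem `sliceClosedWindowT_holds`.

THE MOVE LEMMA (M).  `ν` a probability law on `{0..M}` (mean `S`, `y·M ≤ S`, `ν 0 ≥ z ≥ 0`), a blob `(a ≥ 1, g ≤ 1)` with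
`y ≤ (1−z)g`, `Λ = slice ν a g` (mean `τ = S + ag`), `P = Λ + gz(δ₀ − δ_a)` (mean `t = τ − zag`): **`Λ ∈ D_y(τ, j) ⟹ P ∈ D_y(t, j)`**.
With `ν = gate_q μ`, `z = 1 − q`, `y = qx`: `slice (gate_q μ) a g ∈ D(qT + ag) ⟹ gate_q (slice μ a g) ∈ D(q(T + ag))`, the blob
instance of GM′ ("SDEC is closed under hanging the blob `{0,a;g}` beside `μ` under a common gate"; README V277–V295).  EVIDENCE for (M)
in full (typer g27 `explore/move_impl*.py`, exact LP): 266 976 hypothesis-true instances on ARBITRARY laws / 0 failures; both side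
conditions necessary (489 resp. 1 773 failures without).  PROVED HERE under one extra hypothesis — no unshifted atom strictly between `0`
and `a` (`(1−g)·ν k = 0`, `0 < k < a`; vacuous for `a = 1`, automatic for `g = 1` = Conjecture R) — by the flow transfer of parts 1–2:
(A) no nonzero `t`-low carries mass ⟹ first-moment criterion (`y·(M+a) ≤ t` is `y·M ≤ S ∧ y ≤ (1−z)g`); (B) else `a` is a `t`-low,
`gateMoveBlob_partial` places the nonzero lows into mids, and either everything is placed (remainder = zero low only, mean `≥ t` by
`pair_mean_le`: moment criterion) or the slots are full and the remainder fits the giants (criterion E).  NOT HERE: unshifted lows strictly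
below `a` (`a ≥ 2`, `g < 1`): the normal-form flow (atom `a` giant-first) closes every exact test (53 000 / 0, `explore/primal_t1[12].py`),
no proof yet.  HONEST STATUS: `GateMove`, `GatedConvEmptyFree`, `SDECConvClosed`, `TreeDEC`, `FarTreeRow` OPEN; NEW unconditional family:
SDEC(UpTo Q) is closed under slicing by a single relay of any gate `g ∈ [x, 1]`.

* `LawDec.gateMoveBlob_remainder` — bookkeeping of the remainder after a partial flow into mids (nonnegative; only the zero low left or the
  leftovers; mean inequality).
* **`LawDec.flowAtT_gateMoveBlob`** — (M) as a flow statement under the no-atom-below-`a` hypothesis; **`LawDec.decAtT_gateMoveBlob`**.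
* **`LawDec.sdecUpTo_slice_relay`**, `LawDec.sdec_slice_relay` — `SDECUpTo x Q M μ → SDECUpTo x Q (M+1) (slice μ 1 g)` for `x ≤ g ≤ 1`,
  ANY top-affordable probability law `μ` (no `μ 0 ≥ 1 − g`).

[this work]; GM′: typer g26; R: typer g25–g26; slice theorem: typer g24 / census-2 g54–g55; dominated regime: lead g27 (this lane).
The gluing rows served [cite: KozmaNitzan2024, Conjecture 3 (p. 15)]; product measure [cite: Grimmett1999, §1.3 p. 10].
-/

noncomputable section

namespace Summit.CriticalPhenomena.PercolationContinuityZ3.Theorems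

namespace Quant

open Finset

namespace LawDec

/-! ### The remainder after a partial flow into mids -/

/-- **BOOKKEEPING OF THE REMAINDER.**  `P ≥ 0` a law on `{0..N}` (mass `1`, mean `t > 0`, `y·N ≤ t`), `φ ≥ 0` a partial flow whose charged
pairs are (nonzero `t`-low `l ≤ j`, mid `m ≤ j` with `τ < 2m`, `t < l + m`) for some `τ ≥ t`, shipping at most `P l` out of each nonzero low
and loading every charged column by at most `P`.  Then the remainder `Rem h = P h − Σ_m φ h m − Σ_l usage·φ l h` is nonnegative, equals `P`
at `0` and at the giants, equals `P l − Σ_m φ l m` at the nonzero lows, and has mean at least `t` times its mass. [this work] -/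
theorem gateMoveBlob_remainder (y t τ : ℝ) (j N : ℕ) (P : ℕ → ℝ) (φ : ℕ → ℕ → ℝ)
    (hy0 : 0 < y) (hy1 : y < 1) (htτ : t ≤ τ) (hjN : j < N)
    (hP0 : ∀ h, 0 ≤ P h) (hP1 : ∑ h ∈ Finset.range (N + 1), P h = 1)
    (hPt : ∑ h ∈ Finset.range (N + 1), (h : ℝ) * P h = t) (hta : y * (N : ℝ) ≤ t)
    (hφ0 : ∀ l m, 0 ≤ φ l m)
    (hφch : ∀ l m, 0 < φ l m → (1 ≤ l ∧ l ≤ j ∧ 2 * (l : ℝ) < t) ∧ m ≤ j ∧ τ < 2 * (m : ℝ) ∧ t < (l : ℝ) + m)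
    (hφrow : ∀ l : ℕ, 1 ≤ l → l ≤ j → 2 * (l : ℝ) < t → ∑ m ∈ Finset.range (N + 1), φ l m ≤ P l)
    (hφcol : ∀ h, h ≤ j → τ < 2 * (h : ℝ) → ∑ l ∈ Finset.range (j + 1), usage y t j l h * φ l h ≤ P h) :
    (∀ h, 0 ≤ P h - ∑ m ∈ Finset.range (N + 1), φ h m - ∑ l ∈ Finset.range (j + 1), usage y t j l h * φ l h) ∧
    (∀ h, ¬ (1 ≤ h ∧ h ≤ j ∧ 2 * (h : ℝ) < t) → ∑ m ∈ Finset.range (N + 1), φ h m = 0) ∧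
    (∀ h, ¬ (h ≤ j ∧ τ < 2 * (h : ℝ)) → ∑ l ∈ Finset.range (j + 1), usage y t j l h * φ l h = 0) ∧
    (t * ∑ h ∈ Finset.range (N + 1),
        (P h - ∑ m ∈ Finset.range (N + 1), φ h m - ∑ l ∈ Finset.range (j + 1), usage y t j l h * φ l h)
      ≤ ∑ h ∈ Finset.range (N + 1),
        (h : ℝ) * (P h - ∑ m ∈ Finset.range (N + 1), φ h m - ∑ l ∈ Finset.range (j + 1), usage y t j l h * φ l h)) := by
  have hjN1 : j + 1 ≤ N + 1 := by omega
  have hrow0 : ∀ h, ¬ (1 ≤ h ∧ h ≤ j ∧ 2 * (h : ℝ) < t) → ∑ m ∈ Finset.range (N + 1), φ h m = 0 := by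
    intro h hc
    refine Finset.sum_eq_zero fun m _ => ?_
    by_contra hne
    exact hc (hφch h m (lt_of_le_of_ne (hφ0 h m) (Ne.symm hne))).1
  have hcol0 : ∀ h, ¬ (h ≤ j ∧ τ < 2 * (h : ℝ)) → ∑ l ∈ Finset.range (j + 1), usage y t j l h * φ l h = 0 := by
    intro h hc
    refine Finset.sum_eq_zero fun l _ => ?_
    rcases (hφ0 l h).eq_or_lt with h0 | hp
    · rw [← h0, mul_zero]
    · obtain ⟨_, hm, h2, _⟩ := hφch l h hp
      exact absurd ⟨hm, h2⟩ hc
  have hupos : ∀ l h, 0 ≤ usage y t j l h * φ l h := by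
    intro l h
    rcases (hφ0 l h).eq_or_lt with h0 | hp
    · rw [← h0, mul_zero]
    · obtain ⟨⟨_, _, hl2⟩, _, _, hc⟩ := hφch l h hp
      have hlh : l < h := by
        have : (l : ℝ) < h := by linarith
        exact_mod_cast this
      exact mul_nonneg (usage_pos_of_compat y t j l h hy0 hy1 hl2 hlh (Or.inr hc)).le hp.le
  refine ⟨fun h => ?_, hrow0, hcol0, ?_⟩
  · -- nonnegativity
    by_cases hlow : 1 ≤ h ∧ h ≤ j ∧ 2 * (h : ℝ) < t
    · have hc : ¬ (h ≤ j ∧ τ < 2 * (h : ℝ)) := fun h' => by linarith [h'.2, hlow.2.2]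
      rw [hcol0 h hc, sub_zero, sub_nonneg]
      exact hφrow h hlow.1 hlow.2.1 hlow.2.2
    · rw [hrow0 h hlow, sub_zero]
      by_cases hc : h ≤ j ∧ τ < 2 * (h : ℝ)
      · rw [sub_nonneg]; exact hφcol h hc.1 hc.2
      · rw [hcol0 h hc, sub_zero]; exact hP0 h
  · -- the mean inequality: every charged pair has mean `≤ t`
    have key : ∀ l m : ℕ, (l : ℝ) * φ l m + (m : ℝ) * (usage y t j l m * φ l m) ≤ t * (φ l m + usage y t j l m * φ l m) := by
      intro l m
      rcases (hφ0 l m).eq_or_lt with h0 | hp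
      · rw [← h0]; simp
      · obtain ⟨⟨_, _, hl2⟩, hmj, _, hc⟩ := hφch l m hp
        have hym : y * (m : ℝ) ≤ t := by
          have : y * (m : ℝ) ≤ y * N := mul_le_mul_of_nonneg_left (by exact_mod_cast (hmj.trans hjN.le)) hy0.le
          linarith
        exact pair_mean_le y t j l m (φ l m) hy0 hy1 hl2 hmj hc hym hp.le
    -- rows over `range (N+1)` are rows over `range (j+1)`
    have hrows : ∀ c : ℕ → ℝ, ∑ h ∈ Finset.range (N + 1), c h * ∑ m ∈ Finset.range (N + 1), φ h m
        = ∑ l ∈ Finset.range (j + 1), c l * ∑ m ∈ Finset.range (N + 1), φ l m := by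
      intro c
      rw [← Finset.sum_range_add_sum_Ico _ hjN1]
      have hz : ∑ h ∈ Finset.Ico (j + 1) (N + 1), c h * ∑ m ∈ Finset.range (N + 1), φ h m = 0 :=
        Finset.sum_eq_zero fun h hh => by
          rw [hrow0 h (fun h' => by have := (Finset.mem_Ico.1 hh).1; omega), mul_zero]
      rw [hz, add_zero]
    have hS1 : ∑ h ∈ Finset.range (N + 1), ∑ m ∈ Finset.range (N + 1), φ h m
        = ∑ l ∈ Finset.range (j + 1), ∑ m ∈ Finset.range (N + 1), φ l m := by
      have := hrows (fun _ => 1)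
      simpa only [one_mul] using this
    have hS2 : ∑ h ∈ Finset.range (N + 1), (h : ℝ) * ∑ m ∈ Finset.range (N + 1), φ h m
        = ∑ l ∈ Finset.range (j + 1), (l : ℝ) * ∑ m ∈ Finset.range (N + 1), φ l m := hrows (fun h => (h : ℝ))
    have hS3 : ∑ h ∈ Finset.range (N + 1), ∑ l ∈ Finset.range (j + 1), usage y t j l h * φ l h
        = ∑ l ∈ Finset.range (j + 1), ∑ m ∈ Finset.range (N + 1), usage y t j l m * φ l m := Finset.sum_comm
    have hS4 : ∑ h ∈ Finset.range (N + 1), (h : ℝ) * ∑ l ∈ Finset.range (j + 1), usage y t j l h * φ l h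
        = ∑ l ∈ Finset.range (j + 1), ∑ m ∈ Finset.range (N + 1), (m : ℝ) * (usage y t j l m * φ l m) := by
      rw [Finset.sum_comm]
      exact Finset.sum_congr rfl fun l _ => by rw [Finset.mul_sum]
    have hpairs : ∑ l ∈ Finset.range (j + 1), ((l : ℝ) * ∑ m ∈ Finset.range (N + 1), φ l m
        + ∑ m ∈ Finset.range (N + 1), (m : ℝ) * (usage y t j l m * φ l m))
        ≤ ∑ l ∈ Finset.range (j + 1), (t * (∑ m ∈ Finset.range (N + 1), φ l m
        + ∑ m ∈ Finset.range (N + 1), usage y t j l m * φ l m)) := by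
      refine Finset.sum_le_sum fun l _ => ?_
      rw [Finset.mul_sum, ← Finset.sum_add_distrib, ← Finset.sum_add_distrib, Finset.mul_sum]
      exact Finset.sum_le_sum fun m _ => key l m
    rw [← Finset.mul_sum] at hpairs
    have e1 : ∑ h ∈ Finset.range (N + 1),
        (P h - ∑ m ∈ Finset.range (N + 1), φ h m - ∑ l ∈ Finset.range (j + 1), usage y t j l h * φ l h)
        = 1 - ∑ l ∈ Finset.range (j + 1), (∑ m ∈ Finset.range (N + 1), φ l m
          + ∑ m ∈ Finset.range (N + 1), usage y t j l m * φ l m) := by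
      rw [Finset.sum_sub_distrib, Finset.sum_sub_distrib, hP1, hS1, hS3, Finset.sum_add_distrib]; ring
    have e2 : ∑ h ∈ Finset.range (N + 1),
        (h : ℝ) * (P h - ∑ m ∈ Finset.range (N + 1), φ h m - ∑ l ∈ Finset.range (j + 1), usage y t j l h * φ l h)
        = t - ∑ l ∈ Finset.range (j + 1), ((l : ℝ) * ∑ m ∈ Finset.range (N + 1), φ l m
          + ∑ m ∈ Finset.range (N + 1), (m : ℝ) * (usage y t j l m * φ l m)) := by
      have e : ∀ h ∈ Finset.range (N + 1),
          (h : ℝ) * (P h - ∑ m ∈ Finset.range (N + 1), φ h m - ∑ l ∈ Finset.range (j + 1), usage y t j l h * φ l h)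
          = (h : ℝ) * P h - (h : ℝ) * ∑ m ∈ Finset.range (N + 1), φ h m
            - (h : ℝ) * ∑ l ∈ Finset.range (j + 1), usage y t j l h * φ l h := fun h _ => by ring
      rw [Finset.sum_congr rfl e, Finset.sum_sub_distrib, Finset.sum_sub_distrib, hPt, hS2, hS4, Finset.sum_add_distrib]; ring
    rw [e1, e2]
    linarith

/-! ### The move theorem -/

/-- **THE BLOB GATE MOVE, FLOW FORM (typer g27).**  `0 < y < 1`, `0 ≤ z`, `g ≤ 1`, `y ≤ (1−z)·g`, `1 ≤ a`; `ν` a probability law on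
`{0..M}` with mean `S`, `y·M ≤ S`, `z ≤ ν 0`, no unshifted atom strictly between `0` and `a` (`(1−g)·ν k = 0` for `0 < k < a`); `j < M + a`.
If `slice ν a g ∈ D_y(S + ag, j)` then `slice ν a g + gz(δ₀ − δ_a)` has a flow at `(y, S + ag − zag, j)`. [this work] -/
theorem flowAtT_gateMoveBlob (y z g S : ℝ) (a j M : ℕ) (ν : ℕ → ℝ)
    (hy0 : 0 < y) (hy1 : y < 1) (hz0 : 0 ≤ z) (hg1 : g ≤ 1) (hyg : y ≤ (1 - z) * g) (ha : 1 ≤ a)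
    (hν0 : ∀ h, 0 ≤ ν h) (hνM : ∀ h, M < h → ν h = 0) (hν1 : ∑ h ∈ Finset.range (M + 1), ν h = 1)
    (hS : S = ∑ h ∈ Finset.range (M + 1), (h : ℝ) * ν h) (hta : y * (M : ℝ) ≤ S) (hzν : z ≤ ν 0)
    (hsupp : ∀ k, 0 < k → k < a → (1 - g) * ν k = 0) (hjN : j < M + a)
    (hΛ : DECAtT y (S + (a : ℝ) * g) j (M + a) (slice ν a g)) :
    FlowAtT y (S + (a : ℝ) * g - z * (a : ℝ) * g) j (M + a)
      (fun h => slice ν a g h + g * z * ((if h = 0 then (1 : ℝ) else 0) - (if h = a then (1 : ℝ) else 0))) := by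
  set τ : ℝ := S + (a : ℝ) * g with hτ
  set t : ℝ := S + (a : ℝ) * g - z * (a : ℝ) * g with ht
  set P : ℕ → ℝ := fun h => slice ν a g h + g * z * ((if h = 0 then (1 : ℝ) else 0) - (if h = a then (1 : ℝ) else 0))
    with hP
  have hz1 : z ≤ 1 := by
    have h0 := Finset.single_le_sum (fun h _ => hν0 h) (Finset.mem_range.2 (Nat.succ_pos M))
    rw [hν1] at h0
    exact hzν.trans h0
  have hg0 : 0 < g := by
    by_contra hc
    have : (1 - z) * g ≤ 0 := mul_nonpos_of_nonneg_of_nonpos (by linarith) (not_lt.1 hc)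
    linarith
  have ha0 : (0 : ℝ) < a := by exact_mod_cast ha
  have hS0 : 0 ≤ S := by rw [hS]; exact Finset.sum_nonneg fun h _ => mul_nonneg (Nat.cast_nonneg h) (hν0 h)
  have hzag : 0 ≤ z * (a : ℝ) * g := mul_nonneg (mul_nonneg hz0 ha0.le) hg0.le
  have htτ : t ≤ τ := by rw [ht, hτ]; linarith
  have ht0 : 0 < t := by
    rw [ht]
    have : y * (a : ℝ) ≤ (1 - z) * g * a := mul_le_mul_of_nonneg_right hyg ha0.le
    nlinarith [mul_pos hy0 ha0]
  have htaN : y * ((M + a : ℕ) : ℝ) ≤ t := by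
    rw [ht]; push_cast
    have : y * (a : ℝ) ≤ (1 - z) * g * a := mul_le_mul_of_nonneg_right hyg ha0.le
    nlinarith
  obtain ⟨hP0, hPM, hP1, hPt⟩ := moved_laws ν a M g z ha hg0.le hg1 hz0 hzν hν0 hνM hν1
  have hPt' : ∑ h ∈ Finset.range (M + a + 1), (h : ℝ) * P h = t := by rw [hP, hPt, ← hS, ht]
  by_cases hB : ∃ l : ℕ, 1 ≤ l ∧ l ≤ j ∧ 2 * (l : ℝ) < t ∧ P l ≠ 0
  swap
  · -- (A) only the zero atom is a charged low: the first-moment criterion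
    have hA : ∀ l : ℕ, 1 ≤ l → l ≤ j → 2 * (l : ℝ) < t → P l = 0 := fun l h1 h2 h3 => by
      by_contra hne; exact hB ⟨l, h1, h2, h3, hne⟩
    exact flowAtT_of_moment y t j (M + a) P hy0 hy1 ht0 hP0 hA htaN (by rw [hP1, hPt', mul_one])
  · -- (B) the atom `a` is a low; the partial flow of part 2
    obtain ⟨l₀, hl1, hlj, hl2, hPl⟩ := hB
    have haj : a ≤ j ∧ 2 * (a : ℝ) < t := by
      by_cases hla : l₀ < a
      · exfalso; apply hPl
        have h0 : l₀ ≠ 0 := by omega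
        have hne : l₀ ≠ a := by omega
        simp only [hP, if_neg h0, if_neg hne, sub_self, mul_zero, add_zero]
        rw [slice_apply_of_lt ν a g l₀ hla, hsupp l₀ (by omega) hla]
      · have hal : a ≤ l₀ := not_lt.1 hla
        have : (a : ℝ) ≤ l₀ := by exact_mod_cast hal
        exact ⟨hal.trans hlj, by linarith⟩
    obtain ⟨f, hf⟩ := flowAtT_of_decAtT y τ j (M + a) (slice ν a g) hy0 hy1 hΛ
    have hfcap := hf.2.2.2
    obtain ⟨φ, hφ0, hφsupp, hφmid, hcol, hrowle, hdich⟩ :=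
      gateMoveBlob_partial y z g τ t a j M ν f hy0 hy1 hz0 hg1 hyg ha hν0 hν1 hzν hsupp (by rw [ht, hτ]) hjN haj.1 haj.2 hf
    have hφch : ∀ l m, 0 < φ l m → (1 ≤ l ∧ l ≤ j ∧ 2 * (l : ℝ) < t) ∧ m ≤ j ∧ τ < 2 * (m : ℝ) ∧ t < (l : ℝ) + m := by
      intro l m hp
      obtain ⟨hlj', hl2', _, hc⟩ := hφsupp l m hp
      obtain ⟨hl1', hmj, hm2⟩ := hφmid l m hp
      exact ⟨⟨hl1', hlj', hl2'⟩, hmj, hm2, hc.resolve_left (by omega)⟩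
    have hφcolP : ∀ h, h ≤ j → τ < 2 * (h : ℝ) → ∑ l ∈ Finset.range (j + 1), usage y t j l h * φ l h ≤ P h := by
      intro h hhj hh2
      refine (hcol h hhj).trans ((hfcap h (by omega) (Or.inr hh2.le)).trans (le_of_eq ?_))
      have h0 : h ≠ 0 := by rintro rfl; push_cast at hh2; linarith
      have hha : h ≠ a := by rintro rfl; linarith
      simp only [hP, if_neg h0, if_neg hha, sub_self, mul_zero, add_zero]
    obtain ⟨hR0, hRrow, hRcol, hRmean⟩ := gateMoveBlob_remainder y t τ j (M + a) P φ hy0 hy1 htτ hjN hP0 hP1 hPt' htaN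
      hφ0 hφch hrowle hφcolP
    set Rem : ℕ → ℝ := fun h => P h - ∑ m ∈ Finset.range (M + a + 1), φ h m
      - ∑ l ∈ Finset.range (j + 1), usage y t j l h * φ l h with hRem
    suffices hfin : FlowAtT y t j (M + a) Rem by
      obtain ⟨g', hg'⟩ := hfin
      exact ⟨_, isFlowAtT_of_partial hφ0 hφsupp hg'⟩
    rcases hdich with hall | hgiant
    · -- slots not full: only the zero atom is left low
      refine flowAtT_of_moment y t j (M + a) Rem hy0 hy1 ht0 hR0 (fun l hl1' hlj' hl2' => ?_) htaN hRmean
      have hc : ¬ (l ≤ j ∧ τ < 2 * (l : ℝ)) := fun h' => by linarith [h'.2]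
      simp only [hRem]
      rw [hRcol l hc, hall l hl1' hlj' hl2']; ring
    · -- slots full: the giants take the zero atom and the leftovers
      refine flowAtT_of_giants y t j (M + a) Rem hy0 hy1 hR0 ?_
      have hlhs : ∑ l ∈ Finset.range (j + 1), (if 2 * (l : ℝ) < t then Rem l else 0)
          = (slice ν a g 0 + g * z) + ∑ l ∈ Finset.range (j + 1),
            (if (1 ≤ l ∧ 2 * (l : ℝ) < t) then (P l - ∑ m ∈ Finset.range (M + a + 1), φ l m) else 0) := by
        have e : ∀ l ∈ Finset.range (j + 1), (if 2 * (l : ℝ) < t then Rem l else 0)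
            = (if l = 0 then slice ν a g 0 + g * z else 0)
              + (if (1 ≤ l ∧ 2 * (l : ℝ) < t) then (P l - ∑ m ∈ Finset.range (M + a + 1), φ l m) else 0) := by
          intro l hl
          have hlj' : l ≤ j := Nat.lt_succ_iff.1 (Finset.mem_range.1 hl)
          by_cases hl2' : 2 * (l : ℝ) < t
          · have hc : ¬ (l ≤ j ∧ τ < 2 * (l : ℝ)) := fun h' => by linarith [h'.2]
            rw [if_pos hl2']
            by_cases h0 : l = 0
            · have hc0 : ¬ (1 ≤ l ∧ 2 * (l : ℝ) < t) := fun h' => absurd h'.1 (by omega)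
              have hc1 : ¬ (1 ≤ l ∧ l ≤ j ∧ 2 * (l : ℝ) < t) := fun h' => absurd h'.1 (by omega)
              have ha0ne : l ≠ a := by omega
              rw [if_pos h0, if_neg hc0, add_zero, hRem]
              simp only [hRcol l hc, hRrow l hc1, sub_zero, hP, if_pos h0, if_neg ha0ne]
              rw [h0]; ring
            · rw [if_neg h0, if_pos ⟨by omega, hl2'⟩, zero_add, hRem]
              simp only [hRcol l hc, sub_zero]
          · have h0 : l ≠ 0 := by rintro rfl; push_cast at hl2'; linarith
            rw [if_neg hl2', if_neg h0, if_neg (fun h' => hl2' h'.2), add_zero]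
        rw [Finset.sum_congr rfl e, Finset.sum_add_distrib, Finset.sum_ite_eq' (Finset.range (j + 1)) 0,
          if_pos (Finset.mem_range.2 (Nat.succ_pos j))]
      have hrhs : ∑ h ∈ Finset.Ico (j + 1) (M + a + 1), Rem h = ∑ h ∈ Finset.Ico (j + 1) (M + a + 1), slice ν a g h := by
        refine Finset.sum_congr rfl fun h hh => ?_
        have hhj : j + 1 ≤ h := (Finset.mem_Ico.1 hh).1
        have h0 : h ≠ 0 := by omega
        have hha : h ≠ a := by omega
        rw [hRem]
        simp only [hRrow h (by omega), hRcol h (by omega), sub_zero]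
        simp only [hP, if_neg h0, if_neg hha, sub_self, mul_zero, add_zero]
      rw [hlhs, hrhs]
      exact hgiant

/-- **THE BLOB GATE MOVE (M), DEC FORM**, every layer `j` (layers `≥ M + a`: Theorem A for the top-affordable moved law). [this work] -/
theorem decAtT_gateMoveBlob (y z g S : ℝ) (a j M : ℕ) (ν : ℕ → ℝ)
    (hy0 : 0 < y) (hy1 : y < 1) (hz0 : 0 ≤ z) (hg1 : g ≤ 1) (hyg : y ≤ (1 - z) * g) (ha : 1 ≤ a)
    (hν0 : ∀ h, 0 ≤ ν h) (hνM : ∀ h, M < h → ν h = 0) (hν1 : ∑ h ∈ Finset.range (M + 1), ν h = 1)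
    (hS : S = ∑ h ∈ Finset.range (M + 1), (h : ℝ) * ν h) (hta : y * (M : ℝ) ≤ S) (hzν : z ≤ ν 0)
    (hsupp : ∀ k, 0 < k → k < a → (1 - g) * ν k = 0)
    (hΛ : DECAtT y (S + (a : ℝ) * g) j (M + a) (slice ν a g)) :
    DECAtT y (S + (a : ℝ) * g - z * (a : ℝ) * g) j (M + a)
      (fun h => slice ν a g h + g * z * ((if h = 0 then (1 : ℝ) else 0) - (if h = a then (1 : ℝ) else 0))) := by
  have hz1 : z ≤ 1 := by
    have h0 := Finset.single_le_sum (fun h _ => hν0 h) (Finset.mem_range.2 (Nat.succ_pos M))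
    rw [hν1] at h0
    exact hzν.trans h0
  have hg0 : 0 < g := by
    by_contra hc
    have : (1 - z) * g ≤ 0 := mul_nonpos_of_nonneg_of_nonpos (by linarith) (not_lt.1 hc)
    linarith
  have ha0 : (0 : ℝ) < a := by exact_mod_cast ha
  obtain ⟨hP0, hPM, hP1, hPt⟩ := moved_laws ν a M g z ha hg0.le hg1 hz0 hzν hν0 hνM hν1
  by_cases hjN : j < M + a
  · exact decAtT_of_flowAtT y _ j (M + a) _ hy0 hy1 hPM hP1
      (flowAtT_gateMoveBlob y z g S a j M ν hy0 hy1 hz0 hg1 hyg ha hν0 hνM hν1 hS hta hzν hsupp hjN hΛ)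
  · -- layers at or above the top: Theorem A
    have hmean : ∑ h ∈ Finset.range (M + a + 1),
        (h : ℝ) * (slice ν a g h + g * z * ((if h = 0 then (1 : ℝ) else 0) - (if h = a then (1 : ℝ) else 0)))
        = S + (a : ℝ) * g - z * (a : ℝ) * g := by rw [hPt, ← hS]
    rw [← hmean]
    refine (decAt_iff_decAtT y j (M + a) _).1 (decAt_of_top_le (M + a) _ hP0 hPM hP1 y hy1 (fun h hh => ?_) j (not_lt.1 hjN))
    have hhN : h ≤ M + a := by
      by_contra hc; exact absurd (hPM h (not_le.1 hc)) (ne_of_gt hh)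
    rw [hmean]
    have h1 : y * (h : ℝ) ≤ y * ((M + a : ℕ) : ℝ) := mul_le_mul_of_nonneg_left (by exact_mod_cast hhN) hy0.le
    have h2 : y * (a : ℝ) ≤ (1 - z) * g * a := mul_le_mul_of_nonneg_right hyg ha0.le
    push_cast at h1
    nlinarith

/-! ### SDEC is closed under hanging a single relay beside any law, under a common gate -/

/-- **SDEC-UP-TO-`Q` IS CLOSED UNDER SLICING BY A SINGLE RELAY `{0, 1; g}`** (`x ≤ g ≤ 1`, NO domination hypothesis): `μ` a
top-affordable probability law on `{0..M}`, SDEC up to `Q` at floor `x` (`0 < x`, `Q ≤ 1`, `Qx < 1`) ⟹ `slice μ 1 g` is SDEC up to `Q` at `x`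
on `{0..M+1}`: per gate `q ≤ Q`, the slice theorem gives `slice (gate_q μ) 1 g ∈ D(qT + g)` and `decAtT_gateMoveBlob` (`ν = gate_q μ`,
`z = 1 − q`, `y = qx ≤ qg`) turns it into `gate_q (slice μ 1 g) ∈ D(q(T + g))`.  Tree reading: one pendant relay of any gate `g ≥ x` hung
beside any subtree under a common gate keeps SDEC — the leaf case of `GatedConvEmptyFree`/`GateMove` for every `μ 0`. [this work] -/
theorem sdecUpTo_slice_relay (x Q g : ℝ) (M : ℕ) (μ : ℕ → ℝ) (hx0 : 0 < x) (hQ1 : Q ≤ 1) (hQx : Q * x < 1)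
    (hxg : x ≤ g) (hg1 : g ≤ 1) (hμ0 : ∀ h, 0 ≤ μ h) (hμM : ∀ h, M < h → μ h = 0)
    (hμ1 : ∑ h ∈ Finset.range (M + 1), μ h = 1)
    (hta : x * (M : ℝ) ≤ ∑ h ∈ Finset.range (M + 1), (h : ℝ) * μ h)
    (hS : SDECUpTo x Q M μ) :
    SDECUpTo x Q (M + 1) (slice μ 1 g) := by
  intro q hq0 hqQ j hj
  set T : ℝ := ∑ h ∈ Finset.range (M + 1), (h : ℝ) * μ h with hT
  set y : ℝ := q * x with hy
  have hq1 : q ≤ 1 := hqQ.trans hQ1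
  have hy0 : 0 < y := mul_pos hq0 hx0
  have hy1 : y < 1 := lt_of_le_of_lt (mul_le_mul_of_nonneg_right hqQ hx0.le) hQx
  have hyqg : y ≤ q * g := mul_le_mul_of_nonneg_left hxg hq0.le
  have hqg1 : q * g ≤ 1 := by nlinarith
  obtain ⟨n0, nM, n1⟩ := gate_laws M μ q hq0.le hq1 hμ0 hμM hμ1
  have nmean : ∑ h ∈ Finset.range (M + 1), (h : ℝ) * gate μ q h = q * T := sum_mul_gate μ q M
  have htaν : y * (M : ℝ) ≤ q * T := by rw [hy, mul_assoc]; exact mul_le_mul_of_nonneg_left hta hq0.le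
  -- the slice theorem: `slice (gate_q μ) 1 g` is DEC(j) at `qT + g`
  have hΛ : DECAtT y (q * T + ((1 : ℕ) : ℝ) * g) j (M + 1) (slice (gate μ q) 1 g) := by
    refine sliceClosedWindowT_holds y g (q * T) M 1 j (gate μ q) hy0 hy1 (hyqg.trans (by nlinarith)) hg1 le_rfl n0 nM n1
      (by omega) ?_
    intro j'' _ _
    by_cases hjM : j'' < M
    · have := hS q hq0 hqQ j'' hjM
      rwa [decAt_iff_decAtT, nmean] at this
    · have htop : ∀ h, 0 < gate μ q h → y * (h : ℝ) ≤ ∑ k ∈ Finset.range (M + 1), (k : ℝ) * gate μ q k := by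
        intro h hh
        have hhM : h ≤ M := by
          by_contra hc
          exact (ne_of_gt hh) (nM h (not_le.1 hc))
        rw [nmean]
        have : y * (h : ℝ) ≤ y * M := mul_le_mul_of_nonneg_left (by exact_mod_cast hhM) hy0.le
        linarith
      have := decAt_of_top_le M (gate μ q) n0 nM n1 y hy1 htop j'' (not_lt.1 hjM)
      rwa [decAt_iff_decAtT, nmean] at this
  have hzν : 1 - q ≤ gate μ q 0 := by
    have e : gate μ q 0 = q * μ 0 + (1 - q) := by simp [gate]
    rw [e]; nlinarith [hμ0 0]
  have hmove := decAtT_gateMoveBlob y (1 - q) g (q * T) 1 j M (gate μ q) hy0 hy1 (by linarith) hg1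
    (by rw [hy]; nlinarith) le_rfl n0 nM n1 nmean.symm htaν hzν (fun k hk hka => by omega) hΛ
  have hlaw : (fun h => slice (gate μ q) 1 g h + g * (1 - q) * ((if h = 0 then (1 : ℝ) else 0) - (if h = 1 then (1 : ℝ) else 0)))
      = gate (slice μ 1 g) q := by
    funext h
    simp only [gate, slice]
    by_cases h0 : h = 0
    · subst h0; simp; ring
    · by_cases h1 : h = 1
      · subst h1; simp; ring
      · have h1le : 1 ≤ h := by omega
        have : h - 1 ≠ 0 := by omega
        simp only [if_neg h0, if_neg h1, if_pos h1le, if_neg this]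
        ring
  have hsmean : ∑ h ∈ Finset.range (M + 1 + 1), (h : ℝ) * slice μ 1 g h = T + ((1 : ℕ) : ℝ) * g := sum_mul_slice μ 1 g M hμM hμ1
  rw [decAt_iff_decAtT, sum_mul_gate, hsmean]
  have et : q * (T + ((1 : ℕ) : ℝ) * g) = q * T + ((1 : ℕ) : ℝ) * g - (1 - q) * ((1 : ℕ) : ℝ) * g := by push_cast; ring
  rw [et, ← hlaw]
  exact hmove

/-- **SDEC IS CLOSED UNDER SLICING BY A SINGLE RELAY** (`Q = 1`): `0 < x < 1`, `x ≤ g ≤ 1`, `μ` a top-affordable probability law on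
`{0..M}`, SDEC at `x` ⟹ `slice μ 1 g` is SDEC at `x` on `{0..M+1}`. [this work] -/
theorem sdec_slice_relay (x g : ℝ) (M : ℕ) (μ : ℕ → ℝ) (hx0 : 0 < x) (hx1 : x < 1)
    (hxg : x ≤ g) (hg1 : g ≤ 1) (hμ0 : ∀ h, 0 ≤ μ h) (hμM : ∀ h, M < h → μ h = 0)
    (hμ1 : ∑ h ∈ Finset.range (M + 1), μ h = 1)
    (hta : x * (M : ℝ) ≤ ∑ h ∈ Finset.range (M + 1), (h : ℝ) * μ h) (hS : SDEC x M μ) :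
    SDEC x (M + 1) (slice μ 1 g) := by
  rw [← sdecUpTo_one_iff] at hS ⊢
  exact sdecUpTo_slice_relay x 1 g M μ hx0 le_rfl (by rwa [one_mul]) hxg hg1 hμ0 hμM hμ1 hta hS

end LawDec

end Quant

end Summit.CriticalPhenomena.PercolationContinuityZ3.Theorems
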